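import Summits.QuantumFields.YangMills.Theorems.BalabanUVNodesN17RunWindowShift

/-!
# NODE N17 (NE4) — SUPPLIER ROAD TO K2⁷, FILE 6: THE RUN-KEYED LEVER IN K2⁷ v7's κ-FREE, v₀-FREE CORNER KEYING — «the record's β has in-box corner limits `b`, scale by scale, drifting
# with SOME POSITIVE slope» (v7's registered 2ᶜᴰ `CornerDriftPos`) + node N17 + one-level (C) ⟹ the crux decl BY NAME: node N17's road and v7's 1ᶜᴿ are two roads sharing the ONE stub 2ᶜᴰ

Cell `pub-ymgap`, YM-PLAN Track A (HUMAN RULINGS D-0062 ∕ D-0149), WIDTH SEAT `pub-ymgap-dag-n17-w1` (generation 4), second module.  Key K3⁷ stmt-QuantumFields-20544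
(`--kind proof --supports 20544 --as helper`, COUNT-NEUTRAL); via node N17 also K2⁷ stmt-QuantumFields-20543.  TRIGGER (t2) of this lineage: plan g84's K2⁷ v7 — PRECUT 88baec82280b6909
(fill-keyed own numbers `bOwn_k := β_k(0,…,0)`, NOT registered after the window: the fill is def-B's off-box `beta0OfMerged βm θ.v₀`, dag-n18-w1 g4 ∕ CRIT-2 (P2)) → CORNER RE-KEY draft
39189bf31904f7f3 (`[YMPLAN-G84-K2V7-WINDOW-OUTCOME]`; IN-BOX keying ADOPTED) → ★ REGISTERED v7 **795c9e8285fed415** (2026-08-28T07:44:57Z): 2ᶜᴰ `stub_cornerDriftPos13 : CornerDriftPos` := «prefix → ∃ b s A, ScaleAnchor D.βfun b ∧ 0 < s ∧ OneLoopDrift s A b»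
and 1ᶜᴿ `stub_runChainCornerSlope13 : RunChain190AtCornerDriftSlope` := «prefix → ∀ b s A, ScaleAnchor D.βfun b → 0 < s → OneLoopDrift s A b → NODE O's wall: the remainder `β_k(run prefix) − b_k`
REPRESENTED by (190)-leaves along in-window runs, [II] side conditions, cap `ε₁·K_rem ≤ s`, `SurvCont`».  Continues FILE 5 (p608124, `…N17RunWindowShift`: the generic run-keyed lever, `b` abstract).

THE POINT.  FILE 5 §1 is generic in the reference numbers `b` and in the slope.  Keyed DRIFT-FIRST like v7 but at the CORNER LIMITS of the record's own β — `b` with `ScaleAnchor D.βfun b`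
(the per-scale limits of `β_k` at the zero corner from INSIDE the open box; unique when they exist, DEF-1's `ScaleAnchor.eq`; κ-free, `θ.cβ`-free, and `v₀`-FREE: they read the β of record
only ON the box) — it gives (★★ `endpointExistence_of_cornerDriftPos_runWindowShift_survContAt`): at an admissible tuple, corner limits `b` drifting with SOME slope `s > 0` and with a
summable corner step `|b_{k+1} − b_k| ≤ e_k` + a summable RUN-WINDOW scale shift of `D.βfun` at level `θ.γ` (node N17ʳ, FILE 5) + survivor continuity at ONE positive level ⟹
`EndpointExistence D.C.toB12` (the cap is met because the lever gives EVERY constant remainder); with node N17's BOX letter the corner step is automatic (FILE 1's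
`abs_sub_succ_le_of_shiftModulus_scaleAnchor`), so (★★ `endpointExistence_of_cornerDriftPos_n17At_survContAt`) N17 + «corner limits drifting with a positive slope» + one-level (C) ⟹ END.
Text level (★★★ `EndpointGivenBR13SepCoPH_of_cornerDriftPos13_n17AtRecord13_surv13`): the K2⁷ crux decl BY NAME from 2ᶜᴰ's text VERBATIM + K2⁷ v6∕v7's END-free annex text `N17AtRecord13`
+ «∃ γ₀ > 0, SurvCont» — so node N17's road and v7's XL stub 1ᶜᴿ are TWO ROADS SHARING THE ONE REGISTERED STUB 2ᶜᴰ (plan g84's word on INTENT-2); and (★★★ `…_of_cornerDriftPos13_runWindowSurv13`)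
the same from «2ᶜᴰ ∧ summable corner step» + the RUN-WINDOW N17ʳ text + (C).  What the END consumes of 1ᶜᴿ is only the run-wise BOUND `RunConstRemainder D.βfun b s γ₀ ∧ SurvCont … γ₀` at the
given cap — and node N17 supplies THAT for EVERY cap and WITHOUT the drift (★ `exists_runConstRemainder_survCont_of_n17At_scaleAnchor_survContAt`, 1ᶜᴿ's bound-currency shadow; cf. an4's
`runConstRemainder_of_runLeaves190H`); the (190)-leaf REPRESENTATION, the [II] constants and the threshold seam `c.ε₁ ≤ s∕K_rem` are NODE O's pricing, not the END's need.  Whether the planners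
price the remainder rows through NODE O's structural wall (1ᶜᴿ) or through node N17's letters is their call (count-neutral, no registry ask).

ON THE FILL-KEYED RESERVE (LOCATED).  The PRECUT's `bOwn_k = β_k(0,…,0)` is the value AT the zero history = def-B's off-box FILL (dag-n18-w1 g4; CRIT-2's `Negative/Anchor13FalseOfTwoBaseHistories`:
an ANCHOR at the zero-history values, as a ∀θ text, is false modulo two base histories).  Under the displayed COINCIDENCE letter `∀ k, D.βfun k (fun _ => 0) = b k` the reserve 2ᴼᴰ's drift IS
2ᶜᴰ's corner drift and conversely (`ownDrift_iff_cornerDrift_of_fill`, a rewrite); this file's texts never read the fill.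

HONEST SCOPE (A6, director-ym №189).  Elementary bookkeeping over hypothesis SHAPES (FILE 5's lever instantiated); every letter (corner limits ∕ their drift and sign ∕ corner step ∕ run-window
shift ∕ N17 ∕ (C) ∕ the fill coincidence) is a HYPOTHESIS inhabited at no θ here (instance 0∕1); §1–§2 quantify over `θ : Stage13HParams F 2` with `hP : θ.Provisos₁₃SepCoPH F 2` —
inhabited iff K0⁷ (stmt-QuantumFields-20541).  NOTHING of Bałaban is asserted or instantiated: NE4 NOT IN PRINT ([Balaban1987RG1] p. 264) and NOT proved in any keying; the existence of
corner limits, their drift ∕ AF sign, (C) NOT proved; NOT a proof of `stub_ownDriftPos13`, `stub_runChainOwnSlope13`, `stub_rates13H` or any stub (v7's registration is the plan's act — the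
own-numbers text below is the PRECUT's 2ᴼᴰ conclusion at a tuple, verbatim); N17 NOT discharged (DEPENDENT∕DERIVED row); K2⁷ ∕ K3⁷ OPEN; counts UNMOVED (typed 28∕28 · discharged 5∕27 ·
A 5∕28).  One finite four-torus programme at fixed `ε = L^{−K}`, Bałaban AS PRINTED; the YM mass gap (Clay) is NOT proved by any of this — R4 closes the conditional finite-𝕋⁴ rung
`BalabanLadder.UV` only; nothing continuum ∕ ℝ⁴ ∕ OS.  No `instance`, no `notation`, no `axiom`.  [I] = [Balaban1987RG1] T. Bałaban, CMP **109** (1987): Thm 2 p. 259, (0.20) p. 256,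
(1.3) p. 260, (1.20)–(1.22) p. 264, Thm 3 p. 264, (2.12)–(2.14) p. 268.
-/

noncomputable section

namespace Summit.QuantumFields.YangMills.BalabanUVNodes.N17RunWindowShiftCornerDrift

open Literature.MathematicalPhysics.QuantumFieldTheory.Balaban1983to89
open Literature.MathematicalPhysics.QuantumFieldTheory.Balaban1983to89.FlowStep
open Literature.MathematicalPhysics.QuantumFieldTheory.Balaban1983to89.T4CouplingMatching (ScaleShiftRate)
open Literature.MathematicalPhysics.QuantumFieldTheory.Balaban1983to89.DagBinding (EndpointExistence ForwardGenerated)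
open Literature.MathematicalPhysics.QuantumFieldTheory.Balaban1983to89.T4Continuum (T4Family)
open Literature.MathematicalPhysics.QuantumFieldTheory.Balaban1983to89.Beta.Drift (OneLoopDrift)
open Summit.QuantumFields.YangMills.Theorems.BalabanUVNodesK2NamedJetsRemAt (ScaleAnchor)
open Summit.QuantumFields.YangMills.Theorems.BalabanUVNodesK2NamedJetsRunRemAt (RunConstRemainder SurvCont)
open Summit.QuantumFields.YangMills.Theorems.BalabanUVNodesK2V6Defs (Window13)
open Summit.QuantumFields.YangMills.BalabanUVNodes.N17RunRemAtOfShiftAnchor (abs_sub_succ_le_of_shiftModulus_scaleAnchor scaleShiftRate_of_n17At_window)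
open Summit.QuantumFields.YangMills.BalabanUVNodes.N17RunRemAtOfShiftAnchorLevel (survCont_anti)
open Summit.QuantumFields.YangMills.BalabanUVNodes.N17RunWindowShift (exists_runConstRemainder_of_boxShift_scaleAnchor
  endpointExistence_of_runWindowShift_cornerStep_scaleAnchor_drift_survContAt runWindowShift_of_n17At)
open Finset Filter Topology

/-! ## §1 At NODE 00's Stage-13 record (`N = 2`): corner limits `b` (abstract, `ScaleAnchor D.βfun b`) drifting with SOME positive slope -/

section Record

open YMDAG.UVSplit (U3Carriers N17At)

variable (F : T4Family) (θ : Node00.Stage13HParams F 2) (hP : θ.Provisos₁₃SepCoPH F 2)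

/-- ★★ **THE END AT ONE RECORD, CORNER-LIMIT KEYING, RUN-KEYED N17**: at an admissible tuple — corner limits `b` of the datum's β (`ScaleAnchor`) drifting with SOME slope `s > 0`, a SUMMABLE corner
step `|b_{k+1} − b_k| ≤ e_k`, a SUMMABLE run-window scale shift of `D.βfun` at level `θ.γ` (node N17ʳ), survivor continuity at ONE positive level ⟹ `EndpointExistence D.C.toB12` (FILE 5's generic END
at `hgen := D.fwd`; κ-free, `θ.cβ`-free, `v₀`-free).  CONDITIONAL on every displayed letter. [cite: Balaban1987RG1, Thm 2 p.259 (first sentence), (1.3) p.260, Thm 3 p.264 and (2.12)-(2.14) p.268] -/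
theorem endpointExistence_of_cornerDriftPos_runWindowShift_survContAt (hθ : θ.Admissible F 2) {b a e : ℕ → ℝ} (ha : Summable a) (he : Summable e)
    (hA : ScaleAnchor (Node00.datumOfRecord₁₃SepCoPH F 2 θ hP).βfun b) {s A : ℝ} (hs : 0 < s) (hdrift : OneLoopDrift s A b) (hb : ∀ k, |b (k + 1) - b k| ≤ e k)
    (hW : ∀ (n : ℕ) (gs : ℕ → ℝ), RGEqH n (Node00.datumOfRecord₁₃SepCoPH F 2 θ hP).βfun gs → Step.InInterval θ.γ n gs → ∀ j k : ℕ, j + (k + 1) ≤ n →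
      |(Node00.datumOfRecord₁₃SepCoPH F 2 θ hP).βfun (k + 1) (prefixOf (fun i => gs (j + i)) (k + 1)) -
        (Node00.datumOfRecord₁₃SepCoPH F 2 θ hP).βfun k (prefixOf (fun i => gs (j + 1 + i)) k)| ≤ a k)
    {γ₀ : ℝ} (hγ₀ : 0 < γ₀) (hsc : SurvCont (Node00.datumOfRecord₁₃SepCoPH F 2 θ hP).βfun γ₀) :
    EndpointExistence (Node00.datumOfRecord₁₃SepCoPH F 2 θ hP).C.toB12 :=
  endpointExistence_of_runWindowShift_cornerStep_scaleAnchor_drift_survContAt (Node00.datumOfRecord₁₃SepCoPH F 2 θ hP).fwd hθ.toStage12.toStage9.gamma_pos hA hW ha hb he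
    hs hdrift hγ₀ hsc

/-- ★★ **THE SAME FROM NODE N17's BOX LETTER** (no corner-step hypothesis: with the corner limits in hand the box letter bounds the step, FILE 1's `abs_sub_succ_le_of_shiftModulus_scaleAnchor`; the
run-window shift by restriction, FILE 5's `runWindowShift_of_n17At`): N17 on the datum at a bundle with `u.γ = θ.γ`, `0 ≤ u.ρ < 1` + corner limits drifting with SOME positive slope + one-level
(C) ⟹ END.  (FILE 1∕2 concluded the same only at `b := θ.cβ • beta0OfJs F κ` with slope `θ.cβ · stepBal 2 F.L`; here `b` and `s > 0` are free — v7's «slope first» order, κ-free.)  CONDITIONAL.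
[cite: Balaban1987RG1, Thm 2 p.259 (first sentence), (1.20)-(1.22) p.264 and (2.12)-(2.14) p.268] -/
theorem endpointExistence_of_cornerDriftPos_n17At_survContAt (hθ : θ.Admissible F 2) {u : U3Carriers} (hγu : u.γ = θ.γ) (hρ0 : 0 ≤ u.ρ) (hρ1 : u.ρ < 1)
    (h17 : N17At (Node00.datumOfRecord₁₃SepCoPH F 2 θ hP) u) {b : ℕ → ℝ} (hA : ScaleAnchor (Node00.datumOfRecord₁₃SepCoPH F 2 θ hP).βfun b)
    {s A : ℝ} (hs : 0 < s) (hdrift : OneLoopDrift s A b) {γ₀ : ℝ} (hγ₀ : 0 < γ₀) (hsc : SurvCont (Node00.datumOfRecord₁₃SepCoPH F 2 θ hP).βfun γ₀) :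
    EndpointExistence (Node00.datumOfRecord₁₃SepCoPH F 2 θ hP).C.toB12 := by
  have hγ : 0 < θ.γ := hθ.toStage12.toStage9.gamma_pos
  have hsum : Summable fun k => u.cr * u.C₅ * u.θ * u.ρ ^ k := (summable_geometric_of_lt_one hρ0 hρ1).mul_left _
  exact endpointExistence_of_cornerDriftPos_runWindowShift_survContAt F θ hP hθ hsum hsum hA hs hdrift
    (abs_sub_succ_le_of_shiftModulus_scaleAnchor hγ hA (scaleShiftRate_of_n17At_window F θ hP hγu h17)) (runWindowShift_of_n17At F θ hP hγu h17) hγ₀ hsc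

/-- ★ **1ᶜᴿ's BOUND-CURRENCY SHADOW FROM NODE N17, FOR EVERY CAP AND WITHOUT THE DRIFT**: at an admissible tuple, N17 on the datum at a bundle with `u.γ = θ.γ`, `0 ≤ u.ρ < 1` + corner limits `b`
(`ScaleAnchor D.βfun b`) + survivor continuity at ONE positive level ⟹ for EVERY `s > 0` some level `γ₁ ∈ ]0, θ.γ]` carries BOTH `RunConstRemainder D.βfun b s γ₁` (the remainder `β_k(run prefix) − b_k`
bounded by the cap along the in-window runs) AND `SurvCont D.βfun γ₁` — exactly what DEF-1's run END consumes of v7's 1ᶜᴿ (its (190)-leaf representation enters the END only through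
an4's `runConstRemainder_of_runLeaves190H` + the cap).  FILE 5's box-to-run lever + FILE 2's `survCont_anti`.  CONDITIONAL. [cite: Balaban1987RG1, Thm 3 p.264, (1.20)-(1.22) p.264 and (2.12)-(2.14) p.268] -/
theorem exists_runConstRemainder_survCont_of_n17At_scaleAnchor_survContAt (hθ : θ.Admissible F 2) {u : U3Carriers} (hγu : u.γ = θ.γ) (hρ0 : 0 ≤ u.ρ) (hρ1 : u.ρ < 1)
    (h17 : N17At (Node00.datumOfRecord₁₃SepCoPH F 2 θ hP) u) {b : ℕ → ℝ} (hA : ScaleAnchor (Node00.datumOfRecord₁₃SepCoPH F 2 θ hP).βfun b)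
    {γ₀ : ℝ} (hγ₀ : 0 < γ₀) (hsc : SurvCont (Node00.datumOfRecord₁₃SepCoPH F 2 θ hP).βfun γ₀) {s : ℝ} (hs : 0 < s) :
    ∃ γ₁ : ℝ, 0 < γ₁ ∧ γ₁ ≤ θ.γ ∧ RunConstRemainder (Node00.datumOfRecord₁₃SepCoPH F 2 θ hP).βfun b s γ₁ ∧ SurvCont (Node00.datumOfRecord₁₃SepCoPH F 2 θ hP).βfun γ₁ := by
  have hγ : 0 < θ.γ := hθ.toStage12.toStage9.gamma_pos
  obtain ⟨γs, hγs, hγsγ, hrem⟩ := exists_runConstRemainder_of_boxShift_scaleAnchor hγ hA (scaleShiftRate_of_n17At_window F θ hP hγu h17)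
    ((summable_geometric_of_lt_one hρ0 hρ1).mul_left (u.cr * u.C₅ * u.θ)) hs
  exact ⟨min γs γ₀, lt_min hγs hγ₀, (min_le_left _ _).trans hγsγ, hrem.mono (min_le_left _ _), survCont_anti (lt_min hγs hγ₀) (min_le_right _ _) hsc⟩

/-- **RELATION TO v7's OWN-NUMBERS KEYING (LOCATED)**: under the COINCIDENCE letter «the datum's zero-history values ARE the corner limits» (`∀ k, D.βfun k 0⃗ = b k` — a condition on def-B's off-box
fill `beta0OfMerged βm θ.v₀`, not an estimate; as a ∀θ ANCHOR text false modulo two base histories, CRIT-2 `Negative/Anchor13FalseOfTwoBaseHistories`), a drift of v7's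
`bOwn := fun k => D.βfun k (fun _ => 0)` IS a drift of the corner limits and conversely — a rewrite.  This file's texts never read the fill. [folklore] -/
theorem ownDrift_iff_cornerDrift_of_fill {b : ℕ → ℝ} (hfill : ∀ k, (Node00.datumOfRecord₁₃SepCoPH F 2 θ hP).βfun k (fun _ => 0) = b k) (s A : ℝ) :
    OneLoopDrift s A (fun k => (Node00.datumOfRecord₁₃SepCoPH F 2 θ hP).βfun k (fun _ => 0)) ↔ OneLoopDrift s A b := by
  rw [show (fun k => (Node00.datumOfRecord₁₃SepCoPH F 2 θ hP).βfun k (fun _ => 0)) = b from funext hfill]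

/-- … hence v7's 2ᴼᴰ CONCLUSION AT A TUPLE + the coincidence letter + corner continuity of the fill + node N17ʳ + corner step + one-level (C) ⟹ END (§1 ★★ at `b := bOwn`).  LOCATED: modulo these
N17-lane letters the END consumes of v7's 1ᴼᴿ nothing.  CONDITIONAL; the coincidence∕anchor letter at the fill is the exposed one (see above). [cite: Balaban1987RG1, Thm 2 p.259 (first sentence) and Thm 3 p.264] -/
theorem endpointExistence_of_ownDriftPos_anchorAtFill_runWindowShift_survContAt (hθ : θ.Admissible F 2) {a e : ℕ → ℝ} (ha : Summable a) (he : Summable e)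
    (hA : ScaleAnchor (Node00.datumOfRecord₁₃SepCoPH F 2 θ hP).βfun (fun k => (Node00.datumOfRecord₁₃SepCoPH F 2 θ hP).βfun k (fun _ => 0)))
    {s A : ℝ} (hs : 0 < s) (hdrift : OneLoopDrift s A (fun k => (Node00.datumOfRecord₁₃SepCoPH F 2 θ hP).βfun k (fun _ => 0)))
    (hb : ∀ k, |(Node00.datumOfRecord₁₃SepCoPH F 2 θ hP).βfun (k + 1) (fun _ => 0) - (Node00.datumOfRecord₁₃SepCoPH F 2 θ hP).βfun k (fun _ => 0)| ≤ e k)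
    (hW : ∀ (n : ℕ) (gs : ℕ → ℝ), RGEqH n (Node00.datumOfRecord₁₃SepCoPH F 2 θ hP).βfun gs → Step.InInterval θ.γ n gs → ∀ j k : ℕ, j + (k + 1) ≤ n →
      |(Node00.datumOfRecord₁₃SepCoPH F 2 θ hP).βfun (k + 1) (prefixOf (fun i => gs (j + i)) (k + 1)) -
        (Node00.datumOfRecord₁₃SepCoPH F 2 θ hP).βfun k (prefixOf (fun i => gs (j + 1 + i)) k)| ≤ a k)
    {γ₀ : ℝ} (hγ₀ : 0 < γ₀) (hsc : SurvCont (Node00.datumOfRecord₁₃SepCoPH F 2 θ hP).βfun γ₀) :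
    EndpointExistence (Node00.datumOfRecord₁₃SepCoPH F 2 θ hP).C.toB12 :=
  endpointExistence_of_cornerDriftPos_runWindowShift_survContAt F θ hP hθ ha he hA hs hdrift hb hW hγ₀ hsc

end Record

/-! ## §2 Text level (K2⁷'s full prefix, `Window13` = DEF-1's tree def): the crux decl BY NAME from a CORNER-DRIFT text + a node-N17-lane text -/

section Texts

/-- ★★★ **THE K2⁷ CRUX DECL BY NAME (`Summit.QuantumFields.YangMills.Theses.BalabanUVNodes.EndpointGivenBR13SepCoPH`) FROM TWO κ-FREE, v₀-FREE TEXTS**: (CD13) «at every prefixed tuple the datum's β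
has corner limits `b` scale by scale, drifting with SOME POSITIVE slope and with a summable corner step» (row (D1)'s SIGN + summability read on the record's own corner numbers — the β
sub-cell's ∕ NODE O's (D1)-type content in v7's «slope first» order, `v₀`-free) and (N17ʳS13) «a summable run-window scale shift of the datum's β at level `θ.γ` + survivor continuity at one
positive level» (node N17ʳ + (C)).  Per tuple §1 ★★.  CONDITIONAL on both displayed texts; K2⁷ NOT closed; NOT a proof of any v6∕v7 stub; nothing of Bałaban asserted.
[cite: Balaban1987RG1, Thm 2 p.259 (first sentence), (1.3) p.260, Thm 3 p.264, (1.20)-(1.22) p.264 and (2.12)-(2.14) p.268] -/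
theorem EndpointGivenBR13SepCoPH_of_cornerDriftPos13_runWindowSurv13
    (hCD : ∀ (F : T4Family) (θ : Node00.Stage13HParams F 2) (hP : θ.Provisos₁₃SepCoPH F 2), (θ.ZhUnity F 2 ∧ θ.SlotsNondegenerate₁₃ F 2) → θ.Admissible F 2 →
      B16.EndStatementBPrinted (Node00.datumOfRecord₁₃SepCoPH F 2 θ hP).C → Window13 F θ hP →
      ∃ (b : ℕ → ℝ) (s A : ℝ) (e : ℕ → ℝ), ScaleAnchor (Node00.datumOfRecord₁₃SepCoPH F 2 θ hP).βfun b ∧ 0 < s ∧ OneLoopDrift s A b ∧ Summable e ∧ ∀ k, |b (k + 1) - b k| ≤ e k)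
    (hN : ∀ (F : T4Family) (θ : Node00.Stage13HParams F 2) (hP : θ.Provisos₁₃SepCoPH F 2), (θ.ZhUnity F 2 ∧ θ.SlotsNondegenerate₁₃ F 2) → θ.Admissible F 2 →
      B16.EndStatementBPrinted (Node00.datumOfRecord₁₃SepCoPH F 2 θ hP).C → Window13 F θ hP →
      (∃ a : ℕ → ℝ, Summable a ∧
        ∀ (n : ℕ) (gs : ℕ → ℝ), RGEqH n (Node00.datumOfRecord₁₃SepCoPH F 2 θ hP).βfun gs → Step.InInterval θ.γ n gs → ∀ j k : ℕ, j + (k + 1) ≤ n →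
          |(Node00.datumOfRecord₁₃SepCoPH F 2 θ hP).βfun (k + 1) (prefixOf (fun i => gs (j + i)) (k + 1)) -
            (Node00.datumOfRecord₁₃SepCoPH F 2 θ hP).βfun k (prefixOf (fun i => gs (j + 1 + i)) k)| ≤ a k) ∧
      ∃ γ₀ : ℝ, 0 < γ₀ ∧ SurvCont (Node00.datumOfRecord₁₃SepCoPH F 2 θ hP).βfun γ₀) :
    Summit.QuantumFields.YangMills.Theses.BalabanUVNodes.EndpointGivenBR13SepCoPH := by
  intro F θ hP hU hθ hB hwin
  obtain ⟨b, s, A, e, hA, hs, hdrift, he, hb⟩ := hCD F θ hP hU hθ hB hwin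
  obtain ⟨⟨a, ha, hW⟩, γ₀, hγ₀, hsc⟩ := hN F θ hP hU hθ hB hwin
  exact endpointExistence_of_cornerDriftPos_runWindowShift_survContAt F θ hP hθ ha he hA hs hdrift hb hW hγ₀ hsc

/-- ★★★ **v7's REGISTERED 2ᶜᴰ TEXT `CornerDriftPos` (VERBATIM, `hCD`) + NODE N17's END-free BOX TEXT `N17AtRecord13` (K2⁷ v6∕v7 annex, VERBATIM body) + «∃ γ₀ > 0, SurvCont» ⟹ THE CRUX DECL BY NAME** —
node N17's road in place of 1ᶜᴿ, no corner-step conjunct (the box letter bounds it).  So MODULO NODE N17 (box keying) K2⁷ is: existence of the corner limits + their positive-slope drift + one-level (C) — κ-free, `v₀`-free,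
no value of the slope.  CONDITIONAL on the three displayed texts. [cite: Balaban1987RG1, Thm 2 p.259 (first sentence), Thm 3 p.264, (1.20)-(1.22) p.264 and (2.12)-(2.14) p.268] -/
theorem EndpointGivenBR13SepCoPH_of_cornerDriftPos13_n17AtRecord13_surv13
    (hCD : ∀ (F : T4Family) (θ : Node00.Stage13HParams F 2) (hP : θ.Provisos₁₃SepCoPH F 2), (θ.ZhUnity F 2 ∧ θ.SlotsNondegenerate₁₃ F 2) → θ.Admissible F 2 →
      B16.EndStatementBPrinted (Node00.datumOfRecord₁₃SepCoPH F 2 θ hP).C → Window13 F θ hP →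
      ∃ (b : ℕ → ℝ) (s A : ℝ), ScaleAnchor (Node00.datumOfRecord₁₃SepCoPH F 2 θ hP).βfun b ∧ 0 < s ∧ OneLoopDrift s A b)
    (h17 : ∀ (F : T4Family) (θ : Node00.Stage13HParams F 2) (hP : θ.Provisos₁₃SepCoPH F 2), (θ.ZhUnity F 2 ∧ θ.SlotsNondegenerate₁₃ F 2) → θ.Admissible F 2 →
      B16.EndStatementBPrinted (Node00.datumOfRecord₁₃SepCoPH F 2 θ hP).C → Window13 F θ hP →
      ∃ u : YMDAG.UVSplit.U3Carriers, u.γ = θ.γ ∧ 0 ≤ u.ρ ∧ u.ρ < 1 ∧ YMDAG.UVSplit.N17At (Node00.datumOfRecord₁₃SepCoPH F 2 θ hP) u)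
    (hS : ∀ (F : T4Family) (θ : Node00.Stage13HParams F 2) (hP : θ.Provisos₁₃SepCoPH F 2), (θ.ZhUnity F 2 ∧ θ.SlotsNondegenerate₁₃ F 2) → θ.Admissible F 2 →
      B16.EndStatementBPrinted (Node00.datumOfRecord₁₃SepCoPH F 2 θ hP).C → Window13 F θ hP →
      ∃ γ₀ : ℝ, 0 < γ₀ ∧ SurvCont (Node00.datumOfRecord₁₃SepCoPH F 2 θ hP).βfun γ₀) :
    Summit.QuantumFields.YangMills.Theses.BalabanUVNodes.EndpointGivenBR13SepCoPH := by
  intro F θ hP hU hθ hB hwin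
  obtain ⟨b, s, A, hA, hs, hdrift⟩ := hCD F θ hP hU hθ hB hwin
  obtain ⟨u, hγu, hρ0, hρ1, hN⟩ := h17 F θ hP hU hθ hB hwin
  obtain ⟨γ₀, hγ₀, hsc⟩ := hS F θ hP hU hθ hB hwin
  exact endpointExistence_of_cornerDriftPos_n17At_survContAt F θ hP hθ hγu hρ0 hρ1 hN hA hs hdrift hγ₀ hsc

end Texts

end Summit.QuantumFields.YangMills.BalabanUVNodes.N17RunWindowShiftCornerDrift

end
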